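import Literature.MathematicalPhysics.QuantumLattice.SectorisedKernelNorm
import Literature.MathematicalPhysics.QuantumLattice.SectorWeightAdjacency
import Literature.MathematicalPhysics.QuantumLattice.SectorPropagatorSupBound
import HarnessLib

/-!
# The sectorised single-scale covariance of the BGM instance: fat multipliers and the covariance symbol

Topic `MathematicalPhysics/QuantumLattice`.  Benfatto–Giuliani–Mastropietro 2006, §2.7 (2.66)–(2.67): in the
integration of the scale `h` the sector fields `ψ_{x,ω}` have the covariance
`g^{(h)}_{ω,ω'}(x - y) = (βL²)⁻¹ Σ_k e^{ik(x-y)} F̃_{h,ω}(k) F̃_{h,ω'}(k) f_h(k)χ(k⃗)/D(k)`, the "modified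
functions" `F̃_{h,ω}` being smooth, `≡ 1` on the support of `F_{h,ω} = C_h⁻¹ ζ_{h,ω}` (the leg multipliers
`bgmMultiplier` of `SectorisedKernelNorm`, D1) and supported on the neighbouring sectors.  This file fixes these
objects on the finite torus `(ℤ/2M) × (ℤ/L)²`, in the currency of the single-scale step
`hubbardSectorKernelNorm_effAction_le_of_sectorNorm` (S1: `F`, `F̃` with `F̃F = F`, `C = normalCovariance p`):

* `bgmFatMultiplier L M e₀ β e n ω k = C_{h+1}⁻¹(|{-ik₀}+e(k⃗)|) · Σ_{ω' ≡ ω, ω±1 (mod N), ω' < N} ζ̃_{n,ω'}(θ(k⃗))`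
  — THE FAT MULTIPLIER (scale plateau `C_{h+1}⁻¹ ≡ 1` on `supp C_h⁻¹`, angular plateau of `SectorWeightAdjacency`);
  **`bgmFatMultiplier_mul_bgmMultiplier`** — `F̃_ω F_ω = F_ω` (the hypothesis `hFF` of S1);
* `bgmBand L μ k⃗ = ε(k⃗) - μ` on the centred torus momentum, and **`bgmCovSymbol L M e₀ μ β n (k, σ) =
  βL² Σ_{ω<N} σ_{n,ω}(ω_{k₀}, k⃗) = βL² f_h χ/D`** (`bgmCovSymbol_eq`) — the symbol `p` of the normal covariance
  of the scale-`h` fields (`∫ψ̂⁻ψ̂⁺ = βL² ĝ`, `HubbardSectorPropagatorGram`);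
* `torusCentredMomentum_eq_valMinAbs` — the centred momentum of D1 is `2πk̃/L` with the least-absolute-value
  representative `k̃` (the sampling convention of `SampledSymbolTorusDecay` / `SectorProductSymbolDecay`);
* `norm_bgmFatMultiplier_le_one`, `sum_bgmMultiplier_angular` and the pointwise identity
  **`bgmFatMultiplier_mul_mul_bgmCovSymbol`**: `F̃_ω(k) F̃_{ω'}(k) p(k,σ) = βL² (A_ω A_{ω'})(θ(k⃗)) Σ_{ω''} σ_{ω''}(k)`
  with the pure ANGULAR plateaux `A` — the scale plateaux drop out against `f_h`, so the entries of the sectorised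
  covariance are the product-symbol character sums of `SectorProductSymbolDecay`.

Everything is proved; the definitions are `bgmFatMultiplier`, `bgmBand`, `bgmCovSymbol`; no named facts.

## Sources

G. Benfatto, A. Giuliani, V. Mastropietro, Ann. Henri Poincaré 7 (2006) 809–898, §2.5 (2.45)–(2.48), §2.7
(2.66)–(2.67) (`BenfattoGiulianiMastropietro2006`).
-/

noncomputable section

open Real Set Finset Literature.Probability.LatticeModels

namespace Literature.MathematicalPhysics.QuantumLattice

/-! ### The centred torus momentum is `2πk̃/L` -/

/-- **The centred momentum is `2πk̃/L`** with `k̃ = valMinAbs k ∈ (-L/2, L/2]`. [folklore] -/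
theorem torusCentredMomentum_eq_valMinAbs {L : ℕ} [NeZero L] (k : TorusSite 2 L) :
    torusCentredMomentum L k = fun j => 2 * π / L * (((k j).valMinAbs : ℤ) : ℝ) := by
  funext j
  have hL : (0 : ℝ) < L := Nat.cast_pos.2 (Nat.pos_of_ne_zero (NeZero.ne L))
  rw [torusCentredMomentum, latticeMomentum, toIocMod_eq_iff]
  constructor
  · -- `2πk̃/L ∈ (-π, π]`
    have hm := (k j).valMinAbs_mem_Ioc
    have h1 : (-(L : ℤ) : ℝ) < (((k j).valMinAbs * 2 : ℤ) : ℝ) := by exact_mod_cast hm.1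
    have h2 : (((k j).valMinAbs * 2 : ℤ) : ℝ) ≤ ((L : ℤ) : ℝ) := by exact_mod_cast hm.2
    push_cast at h1 h2
    constructor
    · rw [div_mul_eq_mul_div, lt_div_iff₀ hL]; nlinarith [pi_pos]
    · rw [div_mul_eq_mul_div, div_le_iff₀ hL]; nlinarith [pi_pos]
  · -- `val = k̃ + zL`, `z ∈ {0, 1}`
    rw [ZMod.valMinAbs_def_pos]
    split_ifs with h
    · exact ⟨0, by push_cast; ring⟩
    · refine ⟨1, ?_⟩
      push_cast
      field_simp
      ring

/-! ### The fat multipliers -/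

section Defs

variable (L M : ℕ)

open Classical in
/-- **The fat sector multiplier `F̃_{h,ω}`** of the BGM instance at scale `h = -n` on the band `e`:
the scale plateau `C_{h+1}⁻¹(|{-ik₀} + e(k⃗)|)` (`≡ 1` on the support of `C_h⁻¹`) times the angular plateau
`Σ_{ω' ≡ ω, ω ± 1 (mod N), ω' < N} ζ̃_{n,ω'}(θ(k⃗))` (`≡ 1` on the support of `ζ̃_{n,ω}`); smooth, `[0,1]`-valued,
`≡ 1` on the support of `bgmMultiplier … ω` and supported on the three neighbouring sectors of the scales `≤ h + 1`.
[cite: BenfattoGiulianiMastropietro2006, §2.7 (2.66)] -/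
def bgmFatMultiplier (e₀ β : ℝ) (e : TorusSite 2 L → ℝ) (n : ℕ) (ω : Fin (sectorCount n)) (k : FreqMomentum L M) : ℂ :=
  ((gnScaleCutoff 4 e₀ (-(n : ℤ) + 1) (Real.sqrt (matsubaraFreq β M k.1 ^ 2 + e k.2 ^ 2)) *
      ∑ ω' ∈ (range (sectorCount n)).filter
        (fun ω' : ℕ => ∃ δ : ℤ, |δ| ≤ 1 ∧ (sectorCount n : ℤ) ∣ ((ω' : ℤ) - ((ω : ℕ) : ℤ) - δ)),
        sectorWeightCirc n ω' (momentumAngle L k.2) : ℝ) : ℂ)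

/-- **The BGM band at fixed dispersion**: `e(k⃗) = ε(k⃗) - μ` on the centred torus momentum (the `E_h ≡ ε` case of
BGM 2006, (2.9)/(2.28)). [cite: BenfattoGiulianiMastropietro2006, §2.1 (2.9)] -/
def bgmBand (μ : ℝ) (k : TorusSite 2 L) : ℝ := sqDispersion (torusCentredMomentum L k) - μ

/-- **The covariance symbol of the scale-`h` fields**: `p(k, σ) = βL² Σ_{ω<N} σ_{n,ω}(ω_{k₀}, k⃗)` (`= βL² f_hχ/D`,
`bgmCovSymbol_eq`), the symbol of `normalCovariance` (`∫ψ̂⁻_{kσ}ψ̂⁺_{kσ} = βL² ĝ^{(h)}(k)`), spin-independent.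
[cite: BenfattoGiulianiMastropietro2006, §2.7 (2.67)] -/
def bgmCovSymbol (e₀ μ β : ℝ) (n : ℕ) (ks : FreqMomentum L M × Fin 2) : ℂ :=
  ((β * (L : ℝ) ^ 2 : ℝ) : ℂ) * ∑ ω ∈ range (sectorCount n),
    sectorSymbol e₀ μ n ω (matsubaraFreq β M ks.1.1, torusCentredMomentum L ks.1.2)

end Defs

/-! ### The plateau identities -/

section Plateau

variable {L M : ℕ}

/-- The sum of the sector symbols is `f_h χ / D`. [cite: BenfattoGiulianiMastropietro2006, §2.5 (2.46)–(2.49)] -/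
theorem sum_sectorSymbol_eq (e₀ μ : ℝ) (n : ℕ) (p : ℝ × (Fin 2 → ℝ)) :
    ∑ ω ∈ range (sectorCount n), sectorSymbol e₀ μ n ω p =
      ((scaleCutoffFn e₀ μ n p * zoneBump p.2 : ℝ) : ℂ) / sectorDenom μ p := by
  simp only [sectorSymbol]
  rw [← sum_div, ← Complex.ofReal_sum, ← sum_mul, sum_anisotropicCutoff]

/-- **`p = βL² f_h χ/D`.** [cite: BenfattoGiulianiMastropietro2006, §2.7 (2.67)] -/
theorem bgmCovSymbol_eq (e₀ μ β : ℝ) (n : ℕ) (ks : FreqMomentum L M × Fin 2) :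
    bgmCovSymbol L M e₀ μ β n ks = ((β * (L : ℝ) ^ 2 : ℝ) : ℂ) *
      (((scaleCutoffFn e₀ μ n (matsubaraFreq β M ks.1.1, torusCentredMomentum L ks.1.2) *
          zoneBump (torusCentredMomentum L ks.1.2) : ℝ) : ℂ) /
        sectorDenom μ (matsubaraFreq β M ks.1.1, torusCentredMomentum L ks.1.2)) := by
  rw [bgmCovSymbol, sum_sectorSymbol_eq]

/-- The fat multiplier is real, in `[0, 1]`; in particular `‖F̃_ω(k)‖ ≤ 1`. [folklore] -/
theorem norm_bgmFatMultiplier_le_one (e₀ β : ℝ) (e : TorusSite 2 L → ℝ) (n : ℕ) (ω : Fin (sectorCount n))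
    (k : FreqMomentum L M) : ‖bgmFatMultiplier L M e₀ β e n ω k‖ ≤ 1 := by
  classical
  rw [bgmFatMultiplier, Complex.norm_real, Real.norm_eq_abs]
  have h1 := gnScaleCutoff_mem_Icc 4 e₀ (-(n : ℤ) + 1) (Real.sqrt (matsubaraFreq β M k.1 ^ 2 + e k.2 ^ 2))
  have h2 := fatSectorWeight_mem_Icc n ((ω : ℕ) : ℤ) (momentumAngle L k.2)
  rw [abs_of_nonneg (mul_nonneg h1.1 h2.1)]
  exact mul_le_one₀ h1.2 h2.1 h2.2

/-- **`F̃_ω F_ω = F_ω`** (the hypothesis `hFF` of the single-scale step): on the support of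
`F_ω = C_h⁻¹ ζ̃_ω` both plateaux equal `1`. [cite: BenfattoGiulianiMastropietro2006, §2.7 (2.66)] -/
theorem bgmFatMultiplier_mul_bgmMultiplier [NeZero L] {e₀ : ℝ} (he : 0 < e₀) (β : ℝ) (e : TorusSite 2 L → ℝ) (n : ℕ)
    (ω : Fin (sectorCount n)) (k : FreqMomentum L M) :
    bgmFatMultiplier L M e₀ β e n ω k * bgmMultiplier L M e₀ β e n ω k = bgmMultiplier L M e₀ β e n ω k := by
  classical
  rw [bgmFatMultiplier, bgmMultiplier, ← Complex.ofReal_mul]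
  congr 1
  set t : ℝ := Real.sqrt (matsubaraFreq β M k.1 ^ 2 + e k.2 ^ 2) with ht
  by_cases hC : gnScaleCutoff 4 e₀ (-(n : ℤ)) t = 0
  · rw [hC, zero_mul, mul_zero]
  · -- on the support of `C_h⁻¹`: `t < e₀ 4^{-n}`, so `C_{h+1}⁻¹(t) = 1`
    have hlt : t < e₀ * (4 : ℝ) ^ (-(n : ℤ)) := by
      by_contra hge
      exact hC (gnScaleCutoff_eq_zero (by norm_num) he (not_lt.1 hge))
    have hone : gnScaleCutoff 4 e₀ (-(n : ℤ) + 1) t = 1 :=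
      gnScaleCutoff_eq_one (by norm_num) he (by rw [add_sub_cancel_right]; exact hlt.le)
    rw [hone, one_mul]
    -- the angular plateau: `A_ω (C_h ζ_ω) = C_h (A_ω ζ_ω) = C_h ζ_ω`
    rw [mul_left_comm, fatSectorWeight_mul_sectorWeightCirc n ((ω : ℕ) : ℤ) (momentumAngle L k.2)]

/-- **The multipliers sum to the scale cutoff's angular resolution of unity**: `Σ_ω F_ω(k) = C_h⁻¹(k)` is
`sum_bgmMultiplier`; here the ANGULAR statement `Σ_{ω<N} ζ̃_{n,ω}(θ(k⃗)) = 1` in the leg currency. [folklore] -/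
theorem sum_bgmMultiplier_angular (n : ℕ) (k : FreqMomentum L M) :
    ∑ ω : Fin (sectorCount n), (sectorWeightCirc n ((ω : ℕ) : ℤ) (momentumAngle L k.2) : ℂ) = 1 := by
  rw [← Complex.ofReal_one, ← sum_sectorWeightCirc_eq_one n (momentumAngle L k.2), Complex.ofReal_sum,
    Fin.sum_univ_eq_sum_range (fun i => (sectorWeightCirc n (i : ℤ) (momentumAngle L k.2) : ℂ))]

open Classical in
/-- **The covariance symbol product drops the scale plateaux**: for the band `e = ε - μ`,
`F̃_ω(k) F̃_{ω'}(k) p(k, σ) = βL² (A_ω(θ) A_{ω'}(θ)) Σ_{ω''<N} σ_{n,ω''}(ω_{k₀}, k⃗)` with the angular plateaux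
`A_ω = Σ_{ω₁ ≡ ω, ω±1} ζ̃_{n,ω₁}` (on the support of any `σ_{ω''}`, `|D| < e₀γ^h` and `C_{h+1}⁻¹ = 1`; elsewhere
both sides vanish). [cite: BenfattoGiulianiMastropietro2006, §2.7 (2.66)–(2.67)] -/
theorem bgmFatMultiplier_mul_mul_bgmCovSymbol {e₀ : ℝ} (he : 0 < e₀) (μ β : ℝ) (n : ℕ)
    (ω ω' : Fin (sectorCount n)) (k : FreqMomentum L M) (s : Fin 2) :
    bgmFatMultiplier L M e₀ β (bgmBand L μ) n ω k * bgmFatMultiplier L M e₀ β (bgmBand L μ) n ω' k *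
        bgmCovSymbol L M e₀ μ β n (k, s) =
      ((β * (L : ℝ) ^ 2 : ℝ) : ℂ) *
        (((∑ ω₁ ∈ (range (sectorCount n)).filter
              (fun ω₁ : ℕ => ∃ δ : ℤ, |δ| ≤ 1 ∧ (sectorCount n : ℤ) ∣ ((ω₁ : ℤ) - ((ω : ℕ) : ℤ) - δ)),
              sectorWeightCirc n ω₁ (momentumAngle L k.2)) *
            (∑ ω₂ ∈ (range (sectorCount n)).filter
              (fun ω₂ : ℕ => ∃ δ : ℤ, |δ| ≤ 1 ∧ (sectorCount n : ℤ) ∣ ((ω₂ : ℤ) - ((ω' : ℕ) : ℤ) - δ)),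
              sectorWeightCirc n ω₂ (momentumAngle L k.2)) : ℝ) : ℂ) *
        ∑ ω'' ∈ range (sectorCount n), sectorSymbol e₀ μ n ω'' (matsubaraFreq β M k.1, torusCentredMomentum L k.2) := by
  -- the scale parameter `t = |D|` is the same in the multipliers and in the symbol
  have ht : Real.sqrt (matsubaraFreq β M k.1 ^ 2 + bgmBand L μ k.2 ^ 2) =
      Real.sqrt ((matsubaraFreq β M k.1, torusCentredMomentum L k.2).1 ^ 2 +
        (sqDispersion (matsubaraFreq β M k.1, torusCentredMomentum L k.2).2 - μ) ^ 2) := by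
    simp only [bgmBand]
  by_cases hsum : ∑ ω'' ∈ range (sectorCount n),
      sectorSymbol e₀ μ n ω'' (matsubaraFreq β M k.1, torusCentredMomentum L k.2) = 0
  · -- off the scale support both sides vanish
    rw [bgmCovSymbol]
    simp only [hsum, mul_zero]
  · -- some `σ_{ω''} ≠ 0`: `t < e₀4^{-n}`, the scale plateaux are `1`
    obtain ⟨ω'', -, hω''⟩ := exists_ne_zero_of_sum_ne_zero hsum
    have hF : anisotropicCutoff e₀ μ n ω'' (matsubaraFreq β M k.1, torusCentredMomentum L k.2) ≠ 0 := by
      intro h0; apply hω''; rw [sectorSymbol, h0, zero_mul, Complex.ofReal_zero, zero_div]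
    have hlt := (anisotropicCutoff_ne_zero_scale he hF).2
    rw [← ht] at hlt
    have hone : gnScaleCutoff 4 e₀ (-(n : ℤ) + 1) (Real.sqrt (matsubaraFreq β M k.1 ^ 2 + bgmBand L μ k.2 ^ 2)) = 1 :=
      gnScaleCutoff_eq_one (by norm_num) he (by rw [add_sub_cancel_right]; exact hlt.le)
    rw [bgmFatMultiplier, bgmFatMultiplier, hone, one_mul, one_mul, bgmCovSymbol, ← Complex.ofReal_mul]
    ring

end Plateau

end Literature.MathematicalPhysics.QuantumLattice
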